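import Literature.AlgebraicGeometry.Frobenioids.BiratUnitsTransport
import Literature.AnabelianGeometry.EtaleTheta.BiKummerThm44SubModelBirat
import Literature.AnabelianGeometry.EtaleTheta.BiKummerThm44SubModelPairs
import Literature.AnabelianGeometry.EtaleTheta.BiKummerThm44SubRoots

/-!
# [EtTh] Theorem 4.4 (ii): `Ψ^birat` commutes with the pull-backs `((α')^birat)^*` — the pull-back clause of
# sub-DAG row T44-L10 (the input `hpull` of T44-L14) PROVED at the model; T44-L14 at the canonical model

S. Mochizuki, *The étale theta function …*, Publ. RIMS **45** (2009) [MochizukiEtTh2009], §4, Thm 4.4 (ii), p.94: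
"`Ψ` induces a 1-compatible equivalence of categories `Ψ^birat : C₁^birat ⥲ C₂^birat`. … Finally, `Ψ` maps `N`-th
roots of fraction-pairs … to `N`-th roots of fraction-pairs", proof p.95 ll.7–8 ("The existence of `Ψ^birat` follows
from [FrdI], Corollary 4.10") and ll.12–16; the pull-back `((α')^birat)^* : O^×(A^birat) → O^×(A'^birat)` along an
ARBITRARY morphism `α' : A' → A` is the datum of Prop 4.2 (iii) p.88 — on the rational function monoid `B` of [FrdI]
Thm 5.2 (ii) it is `B(Base α')` ([FrdI] Prop 2.2 (ii): "`O^×(−)`" is a functor on `D`).  Row «hpull» of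
`plan/L2/SUBDAG-EtTh-Thm44.md` (the clause `ψ (pullFrac₁ φ f) = pullFrac₂ (Ψ φ) (ψ f)` consumed by abc-iut-w5-d179's
`Thm44Hyp.preservesNthRoots_of_inputs`, `BiKummerThm44SubRoots.lean`) was the last use the printed proof makes of
`Ψ^birat` that was not yet a theorem at the model (`Thm44Hyp.biratCompatible_mkOfModel`, p424788, covers (a) pre-steps,
(b) fractions, (c) `Aut`-actions).  Here, for ANY pair of §4 settings and the CONSTRUCTED `ψ = Thm44Hyp.psiModel`
(`B₁(A_D) ≅ O^×(A^birat) ≅ O^×(Ψ(A)^birat) ≅ B₂(Ψ(A)_D)`):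

* `Thm44Hyp.intertwines_map` — `Ψ^birat` carries the relation "`φ^birat ∘ u = v ∘ φ^birat` in `C^birat`"
  (`BiratUnits.Intertwines`) to the same relation for `Ψ φ` (apply `Ψ` to the witnessing square);
* `Thm44Hyp.psiVal_map_baseMap_of_isLinear` — along a LINEAR `φ : A' → A`: `ψ_{A'} ∘ B₁(Base φ) = B₂(Base Ψφ) ∘ ψ_A`,
  from [FrdI] Thm 5.2 (ii) naturality (`ModelFrobenioid.ratIso_natural`) on both sides and the uniqueness of the
  intertwiner along a linear morphism of a Frobenioid of isotropic type (`BiratUnits.eq_of_intertwines_of_isLinear`,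
  [FrdI] Prop 1.11 (iv); isotropic by Thm 3.7 (i), PROVED);
* `Thm44Hyp.psiVal_map_baseMap` — along an ARBITRARY `φ` (any Frobenius degree `d`), by a reduction inside the model
  Frobenioid of [FrdI] Thm 5.2 (i): `φ = (d, β, z, u) : (X', α') → (X, α)`; choose `a, b ∈ Φ(X')` with
  `α'⁻¹ · β^*α · [a] = [b]`, put `A'' := (X', α' − a)`, `s := (1, id, a, 1) : A'' → A'` (a pre-step) and
  `φ' := (1, β, b, 1) : A'' → A` (LINEAR, `Base φ' = Base(s ≫ φ)`); both sides of the clause depend on `φ` only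
  through `Base φ` (`Base(Ψφ) = c⁻¹ ≫ Ψ^bs(Base φ) ≫ c`), so the linear case for `φ'` gives the clause for `s ≫ φ`,
  the linear case for `s` then cancels `B₂(Base Ψs)` (`Base Ψs` an isomorphism) — no `d`-torsion enters;
* `Thm44Hyp.psiModel_pullFracModel` — **the clause `hpull` for `pullFrac := pullFracModel`, `ψ := psiModel`**;
* `Thm44Hyp.preservesNthRoots_mkOfModelCanonical` — **T44-L14 "`Ψ` maps `N`-th roots of fraction-pairs to `N`-th
  roots" at the canonical model instances ⇐ {Rmk 3.7.2 (`Remark372 D₀/D₀'`), `hBmon₁/₂`, `Φ_i` perf-factorial,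
  T44-L09c `GaloisCompatible`, T44-L15b `PreservesNHSaturatedBsFld`}** — T44-L03, T44-L04, T44-L10 (+`hpull`),
  T44-L12 and `Thm44_ii` all discharged (p415197/p420137, p419233, p424788 + this file, p420137/p424788).
HONEST FRAMING: refereed pre-IUT material ([EtTh] §4 over [FrdI] §§2, 4, 5); PROOF-ONLY (no definition, no named
fact); nothing here bears on the disputed [IUTchIII] Cor. 3.12; typed ≠ proved — here PROVED.
-/

noncomputable section

namespace Literature.AnabelianGeometry.EtaleTheta

open CategoryTheory Opposite Literature.AlgebraicGeometry.Frobenioids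

namespace BiKummerSetting

universe u₀ v₀ u v w

variable {K : Type u₀} [Field K] {K' : Type u₀} [Field K'] {D₀ : Type u₀} [Category.{v₀} D₀]
  {V : FrdIMonoidStub.{w}}
  {X₁ : SemiGraphs.TemperedArithmeticGroup.{u₀} K} {X₂ : SemiGraphs.TemperedArithmeticGroup.{u₀} K'}
  {D₀' : Type u₀} [Category.{v₀} D₀']
  {T₁ : RealifiedDivisorMonoids (D₀ := D₀) V} {T₂ : RealifiedDivisorMonoids (D₀ := D₀') V}
  {D₁ D₂ : Type u} [Category.{v} D₁] [Category.{v} D₂] {VD₁ : FrdICatStub.{u, v, w} D₁}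
  {VD₂ : FrdICatStub.{u, v, w} D₂}

section AnySetting

variable {S₁ : BiKummerSetting X₁ T₁ D₁ VD₁} {S₂ : BiKummerSetting X₂ T₂ D₂ VD₂}

/-! ### `Ψ^birat` transports the intertwining relation of `C^birat` -/

/-- `Ψ^birat` carries "`φ^birat ∘ u = v ∘ φ^birat` in `C₁^birat`" (`BiratUnits.Intertwines`, [FrdI] Prop 2.2 (ii))
to "`(Ψφ)^birat ∘ Ψ^birat(u) = Ψ^birat(v) ∘ (Ψφ)^birat` in `C₂^birat`": apply `Ψ` to the two fractions and to the
witnessing square (`Ψ` preserves co-angular pre-steps, T44-L03). [cite: MochizukiEtTh2009, Thm 4.4 p.95] -/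
theorem Thm44Hyp.intertwines_map (h : Thm44Hyp S₁ S₂) (hF₁ : PreFrobenioid.IsFrobenioid S₁.F)
    (hF₂ : PreFrobenioid.IsFrobenioid S₂.F) (h3 : h.PreservesFrobeniusStructure) {A A' : S₁.C} {φ : A ⟶ A'}
    {u : PreFrobenioid.BiratUnits S₁.F hF₁ A} {v : PreFrobenioid.BiratUnits S₁.F hF₁ A'}
    (huv : PreFrobenioid.BiratUnits.Intertwines hF₁ φ u v) :
    PreFrobenioid.BiratUnits.Intertwines hF₂ (h.Ψ.functor.map φ) (h.biratUnitsEquiv hF₁ hF₂ h3 A u)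
      (h.biratUnitsEquiv hF₁ hF₂ h3 A' v) := by
  obtain ⟨p, q, E, κ, l, hp, hq, hκ, e₁, e₂⟩ := huv
  subst hp hq
  refine ⟨p.mapEquiv h.Ψ (fun _ _ _ hf => h.isCoAngularPreStep_map h3 hf) (fun _ _ _ _ hb => h.baseEquivalent_map hb),
    q.mapEquiv h.Ψ (fun _ _ _ hf => h.isCoAngularPreStep_map h3 hf) (fun _ _ _ _ hb => h.baseEquivalent_map hb),
    h.Ψ.functor.obj E, h.Ψ.functor.map κ, h.Ψ.functor.map l, rfl, rfl, h.isCoAngularPreStep_map h3 hκ, ?_, ?_⟩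
  · change h.Ψ.functor.map l ≫ h.Ψ.functor.map q.den = h.Ψ.functor.map κ ≫ h.Ψ.functor.map p.den ≫ h.Ψ.functor.map φ
    rw [← Functor.map_comp, e₁, Functor.map_comp, Functor.map_comp]
  · change h.Ψ.functor.map l ≫ h.Ψ.functor.map q.num = h.Ψ.functor.map κ ≫ h.Ψ.functor.map p.num ≫ h.Ψ.functor.map φ
    rw [← Functor.map_comp, e₂, Functor.map_comp, Functor.map_comp]

/-! ### The pull-back clause along LINEAR morphisms -/

/-- **`ψ_{A'} ∘ B₁(Base φ) = B₂(Base Ψφ) ∘ ψ_A` for a LINEAR `φ : A' → A`.**  By [FrdI] Thm 5.2 (ii) (naturality of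
`B ≅ O^×((−)^birat)`, `ModelFrobenioid.ratIso_natural`) `B₁(Base φ)(b)` corresponds to the intertwiner of `b` along
`φ^birat`, and `B₂(Base Ψφ)(ψ_A b)` to the intertwiner of `Ψ^birat(b)` along `(Ψφ)^birat`; `Ψ^birat` carries the
first to an intertwiner of `Ψ^birat(b)` (`intertwines_map`), and intertwiners along a linear morphism of a Frobenioid
of isotropic type are unique ([FrdI] Prop 1.11 (iv), `BiratUnits.eq_of_intertwines_of_isLinear`; Thm 3.7 (i)).
[cite: MochizukiEtTh2009, Thm 4.4 p.95] -/
theorem Thm44Hyp.psiVal_map_baseMap_of_isLinear (h : Thm44Hyp S₁ S₂) (hF₁ : PreFrobenioid.IsFrobenioid S₁.F)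
    (hF₂ : PreFrobenioid.IsFrobenioid S₂.F) (h3 : h.PreservesFrobeniusStructure) {A A' : S₁.C} (φ : A' ⟶ A)
    (hφ : S₁.IsLinear φ) (b : S₁.tf.ratFnFunctor.obj (op A.base)) :
    h.psiVal hF₁ hF₂ h3 A' ((S₁.tf.ratFnFunctor.map (ModelFrobenioid.baseMap φ).op).hom b) =
      (S₂.tf.ratFnFunctor.map (ModelFrobenioid.baseMap (h.Ψ.functor.map φ)).op).hom (h.psiVal hF₁ hF₂ h3 A b) := by
  have n₁ := ModelFrobenioid.ratIso_natural S₁.tf.ratFnFunctor_isGroupLike_holds hF₁.isPreFrobenioid.isDivisorial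
    hF₁ φ hφ b
  have n₁' := h.intertwines_map hF₁ hF₂ h3 n₁
  have n₂ := ModelFrobenioid.ratIso_natural S₂.tf.ratFnFunctor_isGroupLike_holds hF₂.isPreFrobenioid.isDivisorial
    hF₂ (h.Ψ.functor.map φ) (h.isLinear_map h3 hφ) (h.psiVal hF₁ hF₂ h3 A b)
  have e : ModelFrobenioid.ratIso S₂.tf.ratFnFunctor_isGroupLike_holds hF₂.isPreFrobenioid.isDivisorial hF₂
      (h.Ψ.functor.obj A) (h.psiVal hF₁ hF₂ h3 A b) = h.biratUnitsEquiv hF₁ hF₂ h3 A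
        (ModelFrobenioid.ratIso S₁.tf.ratFnFunctor_isGroupLike_holds hF₁.isPreFrobenioid.isDivisorial hF₁ A b) :=
    MulEquiv.apply_symm_apply _ _
  rw [e] at n₂
  have u := PreFrobenioid.BiratUnits.eq_of_intertwines_of_isLinear
    (PreFrobenioid.hasBiratSquares_of_isFrobenioid hF₂) (TemperedFrobenioid.thm37_i_isotropic_holds S₂.tf)
    (h.isLinear_map h3 hφ) n₁' n₂
  show (ModelFrobenioid.ratIso S₂.tf.ratFnFunctor_isGroupLike_holds hF₂.isPreFrobenioid.isDivisorial hF₂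
      (h.Ψ.functor.obj A')).symm (h.biratUnitsEquiv hF₁ hF₂ h3 A'
        (ModelFrobenioid.ratIso S₁.tf.ratFnFunctor_isGroupLike_holds hF₁.isPreFrobenioid.isDivisorial hF₁ A'
          ((S₁.tf.ratFnFunctor.map (ModelFrobenioid.baseMap φ).op).hom b))) = _
  rw [MulEquiv.symm_apply_eq]
  exact u

/-! ### The pull-back clause along ARBITRARY morphisms -/

/-- **`ψ_{A'} ∘ B₁(Base φ) = B₂(Base Ψφ) ∘ ψ_A` for an ARBITRARY morphism `φ : A' → A`** of the §4 Frobenioid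
(any Frobenius degree).  Reduction inside the model Frobenioid of [FrdI] Thm 5.2 (i): with `φ = (d, β, z, u) :
(X', α') → (X, α)`, choose `a, b ∈ Φ(X')` with `α'⁻¹ · β^*α · [a] = [b]`; then `s := (1, id, a, 1) : (X', α' − a) → A'`
is a pre-step and `φ' := (1, β, b, 1) : (X', α' − a) → A` is LINEAR with `Base φ' = Base(s ≫ φ)`.  Both sides of the
clause depend on the morphism only through its base (`Base(Ψχ) = c⁻¹ ≫ Ψ^bs(Base χ) ≫ c`), so the linear case for
`φ'` is the clause for `s ≫ φ`; with the linear case for `s`, cancel `B₂(Base Ψs)` (`Base Ψs` is an isomorphism).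
[cite: MochizukiEtTh2009, Thm 4.4 p.95] -/
theorem Thm44Hyp.psiVal_map_baseMap (h : Thm44Hyp S₁ S₂) (hF₁ : PreFrobenioid.IsFrobenioid S₁.F)
    (hF₂ : PreFrobenioid.IsFrobenioid S₂.F) (h3 : h.PreservesFrobeniusStructure) {A A' : S₁.C} (φ : A' ⟶ A)
    (b : S₁.tf.ratFnFunctor.obj (op A.base)) :
    h.psiVal hF₁ hF₂ h3 A' ((S₁.tf.ratFnFunctor.map (ModelFrobenioid.baseMap φ).op).hom b) =
      (S₂.tf.ratFnFunctor.map (ModelFrobenioid.baseMap (h.Ψ.functor.map φ)).op).hom (h.psiVal hF₁ hF₂ h3 A b) := by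
  -- the data: `a, b'` with `α'⁻¹ · β^*α · [a] = [b']`
  obtain ⟨b', a, hab⟩ := grothendieckGroup_exists_mul_of_eq_of
    (A'.cls⁻¹ * pullGp S₁.tf.divisorMonoid (ModelFrobenioid.baseMap φ) A.cls)
  -- the pre-step `s = (1, id, a, 1) : (X', α' − a) → A'` and the linear `φ' = (1, β, b', 1) : (X', α' − a) → A`
  let s : ModelFrobenioid.stdSrc A' a ⟶ A' := ModelFrobenioid.stdDen A' a
  let φ' : ModelFrobenioid.stdSrc A' a ⟶ A :=
    { degFr := 1
      base := show A'.base ⟶ A.base from ModelFrobenioid.baseMap φ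
      div := show S₁.tf.divisorMonoid.obj (op A'.base) from b'
      unit := 1
      rel := by
        change (A'.cls * (Algebra.GrothendieckGroup.of a)⁻¹) ^ ((1 : ℕ+) : ℕ) * Algebra.GrothendieckGroup.of b' =
          pullGp S₁.tf.divisorMonoid (ModelFrobenioid.baseMap φ) A.cls *
            divB S₁.tf.divisorMonoid S₁.tf.ratFnFunctor S₁.tf.divBNatTrans (op A'.base) 1
        rw [PNat.one_coe, pow_one, map_one, mul_one, ← hab,
          mul_comm (A'.cls⁻¹ * pullGp S₁.tf.divisorMonoid (ModelFrobenioid.baseMap φ) A.cls)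
            (Algebra.GrothendieckGroup.of a),
          mul_assoc, inv_mul_cancel_left, mul_inv_cancel_left] }
  have hs : S₁.IsPreStep s := (ModelFrobenioid.isCoAngularPreStep_stdDen S₁.tf.ratFnFunctor_isGroupLike_holds a).2
  have hφ' : S₁.IsLinear φ' := rfl
  have hbase : ModelFrobenioid.baseMap (s ≫ φ) = ModelFrobenioid.baseMap φ' := by
    rw [ModelFrobenioid.baseMap_comp]
    exact Category.id_comp _
  have hΨbase : ModelFrobenioid.baseMap (h.Ψ.functor.map (s ≫ φ)) = ModelFrobenioid.baseMap (h.Ψ.functor.map φ') :=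
    h.baseEquivalent_map hbase
  -- the linear cases
  have P₁ := h.psiVal_map_baseMap_of_isLinear hF₁ hF₂ h3 s hs.1
    ((S₁.tf.ratFnFunctor.map (ModelFrobenioid.baseMap φ).op).hom b)
  have P₂ := h.psiVal_map_baseMap_of_isLinear hF₁ hF₂ h3 φ' hφ' b
  -- the clause for `s ≫ φ`, by base-equivalence with `φ'`
  have P₃ : h.psiVal hF₁ hF₂ h3 _ ((S₁.tf.ratFnFunctor.map (ModelFrobenioid.baseMap (s ≫ φ)).op).hom b) =
      (S₂.tf.ratFnFunctor.map (ModelFrobenioid.baseMap (h.Ψ.functor.map (s ≫ φ))).op).hom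
        (h.psiVal hF₁ hF₂ h3 A b) := by
    rw [hbase, hΨbase]
    exact P₂
  -- expand the composites
  have e₁ : (S₁.tf.ratFnFunctor.map (ModelFrobenioid.baseMap (s ≫ φ)).op).hom b =
      (S₁.tf.ratFnFunctor.map (ModelFrobenioid.baseMap s).op).hom
        ((S₁.tf.ratFnFunctor.map (ModelFrobenioid.baseMap φ).op).hom b) := by
    rw [ModelFrobenioid.baseMap_comp, op_comp, Functor.map_comp, CommMonCat.comp_apply]
  have e₂ : (S₂.tf.ratFnFunctor.map (ModelFrobenioid.baseMap (h.Ψ.functor.map (s ≫ φ))).op).hom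
        (h.psiVal hF₁ hF₂ h3 A b) =
      (S₂.tf.ratFnFunctor.map (ModelFrobenioid.baseMap (h.Ψ.functor.map s)).op).hom
        ((S₂.tf.ratFnFunctor.map (ModelFrobenioid.baseMap (h.Ψ.functor.map φ)).op).hom (h.psiVal hF₁ hF₂ h3 A b)) := by
    rw [Functor.map_comp, ModelFrobenioid.baseMap_comp, op_comp, Functor.map_comp, CommMonCat.comp_apply]
  rw [e₁, P₁, e₂] at P₃
  haveI : IsIso (ModelFrobenioid.baseMap (h.Ψ.functor.map s)) := (h.isPreStep_map h3 hs).2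
  exact ModelFrobenioid.map_injective_of_isIso (ModelFrobenioid.baseMap (h.Ψ.functor.map s)) P₃

/-- **The pull-back clause `hpull` of T44-L10 / T44-L14 DISCHARGED for the model rendering**: with
`pullFrac := pullFracModel` (`B(Base φ)` on units, [EtTh] Prop 4.2 (iii) `((α')^birat)^*`) and the CONSTRUCTED
`ψ := psiModel`, `ψ_{A'} (((φ)^birat)^* f) = ((Ψφ)^birat)^* (ψ_A f)` for every morphism `φ : A' → A`.
[cite: MochizukiEtTh2009, Thm 4.4 p.95] -/
theorem Thm44Hyp.psiModel_pullFracModel (h : Thm44Hyp S₁ S₂) (hF₁ : PreFrobenioid.IsFrobenioid S₁.F)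
    (hF₂ : PreFrobenioid.IsFrobenioid S₂.F) (h3 : h.PreservesFrobeniusStructure) {A A' : S₁.C} (φ : A' ⟶ A)
    (f : S₁.tf.biratUnitsModel A) :
    h.psiModel hF₁ hF₂ h3 A' (S₁.tf.pullFracModel φ f) =
      S₂.tf.pullFracModel (h.Ψ.functor.map φ) (h.psiModel hF₁ hF₂ h3 A f) :=
  Units.ext (h.psiVal_map_baseMap hF₁ hF₂ h3 φ (f : S₁.tf.ratFnFunctor.obj (op A.base)))

end AnySetting

/-! ### T44-L14 at the canonical model instances `mkOfModelCanonical` -/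

section Canonical

variable {T₁' : RealifiedDivisorMonoids (D₀ := D₀) treeMonoidVocab.{w}}
  {T₂' : RealifiedDivisorMonoids (D₀ := D₀') treeMonoidVocab.{w}}
  {IsRational₁ IsStrictlyRational₁ : (D₁ᵒᵖ ⥤ CommMonCat.{w}) → Prop}
  {IsRational₂ IsStrictlyRational₂ : (D₂ᵒᵖ ⥤ CommMonCat.{w}) → Prop}
  {tf₁ : TemperedFrobenioid T₁' D₁ (treeCatVocab D₁ IsRational₁ IsStrictlyRational₁)}
  {hZ₁ : tf₁.monoidType = MonoidType.Z} {hP₁ : ∀ A : D₁ᵒᵖ, IsPerfect (tf₁.Φ.carrier A)}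
  {IG₁ : D₁ → Prop} {gS₁ : ∀ A : D₁, IG₁ A → (X₁.Pi →* Aut A)}
  {gSs₁ : ∀ (A : D₁) (hA : IG₁ A), Function.Surjective (gS₁ A hA)}
  {NH₁ : Subgroup (Field.absoluteGaloisGroup K) → tf₁.category → ℕ+ → Prop} {A₀₁ : tf₁.category}
  {hA₀₁ : PreFrobenioid.IsFrobeniusTrivial tf₁.toElem A₀₁} {hA₀₁' : IG₁ A₀₁.base}
  {tf₂ : TemperedFrobenioid T₂' D₂ (treeCatVocab D₂ IsRational₂ IsStrictlyRational₂)}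
  {hZ₂ : tf₂.monoidType = MonoidType.Z} {hP₂ : ∀ A : D₂ᵒᵖ, IsPerfect (tf₂.Φ.carrier A)}
  {IG₂ : D₂ → Prop} {gS₂ : ∀ A : D₂, IG₂ A → (X₂.Pi →* Aut A)}
  {gSs₂ : ∀ (A : D₂) (hA : IG₂ A), Function.Surjective (gS₂ A hA)}
  {NH₂ : Subgroup (Field.absoluteGaloisGroup K') → tf₂.category → ℕ+ → Prop} {A₀₂ : tf₂.category}
  {hA₀₂ : PreFrobenioid.IsFrobeniusTrivial tf₂.toElem A₀₂} {hA₀₂' : IG₂ A₀₂.base}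

/-- **T44-L14 "`Ψ` maps `N`-th roots of fraction-pairs to `N`-th roots of fraction-pairs" ([EtTh] Thm 4.4 (ii),
last sentence) at the canonical model instances**, for the CONSTRUCTED `ψ = Ψ^birat` (`psiModel`) and the model
pull-backs `pullFracModel` ⇐ {Rmk 3.7.2 (`Remark372 D₀ / D₀'`), `hBmon₁ / hBmon₂`, "`Φ_i` perf-factorial", T44-L09c
(`GaloisCompatible`, [SemiAnbd] Prop 3.2), T44-L15b (`PreservesNHSaturatedBsFld`, [FrdII] Def 2.2 (ii))} — the rows
T44-L03 ([FrdI] Thm 3.4), T44-L04 ([FrdI] Cor 5.7), T44-L10 with its pull-back clause ([FrdI] Cor 4.10 / Prop 2.2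
(ii)), T44-L12 ([FrdI] Thm 4.2 (ii)) and `Thm44_ii` being theorems here. [cite: MochizukiEtTh2009, Thm 4.4 p.94] -/
theorem Thm44Hyp.preservesNthRoots_mkOfModelCanonical
    (h : Thm44Hyp (mkOfModelCanonical X₁ tf₁ hZ₁ hP₁ IG₁ gS₁ gSs₁ NH₁ A₀₁ hA₀₁ hA₀₁')
      (mkOfModelCanonical X₂ tf₂ hZ₂ hP₂ IG₂ gS₂ gSs₂ NH₂ A₀₂ hA₀₂ hA₀₂'))
    (h372 : TemperedFrobenioid.Remark372 D₀) (h372' : TemperedFrobenioid.Remark372 D₀')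
    (hBmon₁ : IsMonoidOn tf₁.ratFnFunctor) (hBmon₂ : IsMonoidOn tf₂.ratFnFunctor)
    (hpf₁ : ∀ A : D₁ᵒᵖ, IsPerfFactorial (tf₁.Φ.carrier A))
    (hpf₂ : ∀ A : D₂ᵒᵖ, IsPerfFactorial (tf₂.Φ.carrier A))
    (h9 : h.GaloisCompatible) (h15 : h.PreservesNHSaturatedBsFld) :
    h.PreservesNthRoots (h.psiModel (tf₁.isFrobenioid_treeCatVocab_of_isMonoidOn hBmon₁)
      (tf₂.isFrobenioid_treeCatVocab_of_isMonoidOn hBmon₂)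
      (h.preservesFrobeniusStructure_treeVocab h372 h372' hBmon₁ hBmon₂))
      (fun φ f => tf₁.pullFracModel φ f) (fun φ f => tf₂.pullFracModel φ f) :=
  h.preservesNthRoots_of
    (h.psiModel (tf₁.isFrobenioid_treeCatVocab_of_isMonoidOn hBmon₁) (tf₂.isFrobenioid_treeCatVocab_of_isMonoidOn hBmon₂)
      (h.preservesFrobeniusStructure_treeVocab h372 h372' hBmon₁ hBmon₂))
    (fun φ f => tf₁.pullFracModel φ f) (fun φ f => tf₂.pullFracModel φ f)
    (fun φ f => h.psiModel_pullFracModel (tf₁.isFrobenioid_treeCatVocab_of_isMonoidOn hBmon₁)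
      (tf₂.isFrobenioid_treeCatVocab_of_isMonoidOn hBmon₂) (h.preservesFrobeniusStructure_treeVocab h372 h372' hBmon₁ hBmon₂)
      φ f)
    (thm44_ii_mkOfModelCanonical h h372 h372' hBmon₁ hBmon₂)
    (h.preservesFrobeniusStructure_treeVocab h372 h372' hBmon₁ hBmon₂)
    (h.preservesBaseFrobeniusTypeData_of_inputs (h.preservesFrobeniusStructure_treeVocab h372 h372' hBmon₁ hBmon₂)
      (Thm44Hyp.preservesBaseFrobeniusPairs_mkOfModelCanonical _ _ _ _ _ _ _ _ _ _ _ _ _ _ _ _ _ _ _ _ h h372 h372'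
        hBmon₁ hBmon₂ hpf₁ hpf₂) h9)
    (h.preservesAmple_of h9)
    (h.preservesFixedByHA_of _ h9 (h.biratCompatible_mkOfModel (tf₁.isFrobenioid_treeCatVocab_of_isMonoidOn hBmon₁)
      (tf₂.isFrobenioid_treeCatVocab_of_isMonoidOn hBmon₂) (h.preservesFrobeniusStructure_treeVocab h372 h372' hBmon₁ hBmon₂)))
    (h.preservesSaturated_of _ (h.preservesFrobeniusStructure_treeVocab h372 h372' hBmon₁ hBmon₂) h15)

end Canonical

end BiKummerSetting

end Literature.AnabelianGeometry.EtaleTheta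

end
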